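import Literature.Barriers.MatrixMultiplication.IrreversibilityBarrier
import Literature.Barriers.MatrixMultiplication.IrreversibilityBarrierProp5
import Literature.Computability.AlgebraicComplexity.RelativeExponentTriangle
import Literature.Computability.AlgebraicComplexity.MonomialRestrictionProducts
import Literature.Computability.AlgebraicComplexity.MatMulMonomialSubrankAsymptotics
import HarnessLib

/-!
# Proof of `CVZ2021_thm10` (Christandl–Vrana–Zuiddam 2021, Thm. 10: the `τ`-theorem barrier)

Topic `Literature/Barriers/MatrixMultiplication`; DISCHARGE of the named fact `CVZ2021_thm10` of
the catalogue entry `IrreversibilityBarrier.lean` (M. Christandl, P. Vrana, J. Zuiddam, *Barriers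
for fast matrix multiplication from irreversibility*, Theory of Computing 17 (2021), art. 2 =
arXiv:1812.06952; **arXiv v1/v2 numbering**, Thm. 10 on p. 7, page-checked with `lit read`:
"For any tensor `t` and `α, β ∈ ℕ` holds
`(ω(⟨2⟩,t) ω(t, ⟨2⟩^α ⟨2,2,2⟩^β) − α)/β ≥ 2 i(t) + (α/β)(i(t) − 1) ≥ 2 i(t)`.").
The fact stays a `def`; users `(h : CVZ2021_thm10)` are fed `CVZ2021_thm10_holds`.

## The printed proof and the proof given here

CVZ: by the triangle inequality (Prop. 3),
`ω(⟨2⟩,t) ω(t,s) ω(s,⟨2⟩) ≥ ω(⟨2⟩,t) ω(t,⟨2⟩) = i(t)` for `s = ⟨2⟩^{⊗α} ⊗ ⟨2,2,2⟩^{⊗β}`, and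
`ω(s,⟨2⟩) = 1/(α + 2β)` (Strassen: `Q̃(⟨h,h,h⟩) = h²`); subtract `α`, divide by `β`.

Writing `a = ω(⟨2⟩,t) ≥ 0`, `b = ω(t,⟨2⟩)`, `c = ω(t,s)`, the vendored inequality (with `0 < β`)
is `(α + 2β)·a·b ≤ a·c` rearranged, so it suffices to prove

  `(α + 2β) · ω(t,⟨2⟩) ≤ ω(t, ⟨2⟩^{⊗α} ⊗ ⟨2,2,2⟩^{⊗β})`.                                    (★)

We prove (★) directly for the tree's infimum formalisation
`ω(t,s) = ⨅ₙ (n+1)⁻¹ min {m | t^{⊗m} ≥ s^{⊗(n+1)}}` (junk `min ∅ = 0`), in the general form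
`mul_relativeExponent_unit_le_relativeExponent`: **if `s^{⊗N} ≥ ⟨2⟩^{⊗P}` with `P ≥ (ρ − ε)N` for
all large `N` (every `ε > 0`), then `ρ · ω(t,⟨2⟩) ≤ ω(t,s)`**. Term by term in `n`: if no power of
`t` restricts to `s^{⊗(n+1)}`, then (every tensor lies below a power of `⟨2⟩`,
`exists_unitTensor_pow_restrictsTo`) no power of `t` restricts to some `⟨2⟩^{⊗(q+1)}` either and
`ω(t,⟨2⟩)` is the junk `0`; otherwise the minimal witness `t^{⊗m} ≥ s^{⊗(n+1)}` chains with
`s^{⊗N} ≥ ⟨2⟩^{⊗P}` to `t^{⊗Nm} ≥ ⟨2⟩^{⊗(n+1)P}` (`tensorRestrictsTo_chain`), whence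
`ω(t,⟨2⟩) ≤ Nm/((n+1)P) ≤ m/((ρ−ε)(n+1))`, and `ε → 0`. This is the part of the triangle
inequality that is needed, with the junk cases built in (no finiteness hypothesis survives in the
statement). The rate hypothesis for `s = ⟨2⟩^{⊗α} ⊗ ⟨2,2,2⟩^{⊗β}`, `ρ = α + 2β`
(`unitPow_kronecker_matMulPow_rate`), comes from
`s^{⊗N} ≥ (⟨2⟩^{⊗α})^{⊗N} ⊗ (⟨2,2,2⟩^{⊗β})^{⊗N} ≥ ⟨2⟩^{⊗Nα} ⊗ ⟨2,2,2⟩^{⊗Nβ} ≥ ⟨2⟩^{⊗Nα} ⊗ ⟨2⟩^{⊗r}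
≥ ⟨2⟩^{⊗(Nα + r)}` with `r ≥ (2 − ε/β)Nβ` supplied by the tree's Behrend/Ruzsa–Szemerédi bound
`exists_tensorMonRestrictsTo_kroneckerPow_matMulTensor_unitTensor`
(`MatMulMonomialSubrankAsymptotics.lean`: `⟨2,2,2⟩^{⊗L} ≥_M ⟨2⟩^{⊗r}`, `r ≥ (2−ε)L`, i.e. the
constructive half `Q̃(⟨2,2,2⟩) ≥ 4` of Strassen's `Q̃(⟨h,h,h⟩) = h²`, here even monomially), and
the relabelling calculus of `MonomialRestrictionProducts.lean` / `MatMulMonomialSubrank.lean`.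
Assumption 1 (`t` not a triad) is not used.

## Content

* `mul_relativeExponent_unit_le_relativeExponent` — the rate lemma (★) in general form.
* `unitPow_kronecker_matMulPow_rate` — the rate hypothesis for `⟨2⟩^{⊗α} ⊗ ⟨2,2,2⟩^{⊗β}`,
  `ρ = α + 2β` (`β ≥ 1`).
* `CVZ2021_thm10_holds : CVZ2021_thm10`.

## References

* M. Christandl, P. Vrana, J. Zuiddam, ToC 17 (2021), art. 2 = arXiv:1812.06952, Def. 2, Prop. 3,
  §3.2 and Thm. 10 (p. 7). [ChristandlVranaZuiddam2021]
* V. Strassen, J. reine angew. Math. 384 (1988), `Q̃(⟨h,h,h⟩) = h²` (quoted in CVZ §2.1).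
  [Strassen1988]
-/

noncomputable section

open scoped BigOperators

namespace Literature.Barriers.MatrixMultiplication

open Literature.Computability.AlgebraicComplexity

universe u

section Rate

variable {K : Type u} [CommSemiring K]
variable {ι κ μ ι' κ' μ' : Type*} [Fintype ι] [Fintype κ] [Fintype μ] [Fintype ι'] [Fintype κ']
  [Fintype μ']

/-- `⟨2⟩^{⊗(q+1)} ≥ ⟨2⟩^{⊗q}` (through `⟨2^{q+1}⟩ ≥ ⟨2^q⟩`). [folklore] -/
theorem unitTensorPow_succ_restrictsTo (q : ℕ) :
    TensorRestrictsTo (kroneckerPow (unitTensor K 2) (q + 1)) (kroneckerPow (unitTensor K 2) q) :=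
  ((tensorMonRestrictsTo_pow_unitTensor (K := K) 2 (q + 1)).tensorRestrictsTo.trans
    (tensorRestrictsTo_unitTensor_castLE (K := K)
      (Nat.pow_le_pow_right (by norm_num) (Nat.le_succ q)))).trans
    (tensorMonRestrictsTo_unitTensor_pow (K := K) 2 q).tensorRestrictsTo

/-- **The rate lemma (★).** If for every `ε > 0` and all large `N` some `P ≥ (ρ − ε) N` has
`s^{⊗N} ≥ ⟨2⟩^{⊗P}` (the constructive content of `ω(s,⟨2⟩) ≤ 1/ρ`), then
`ρ · ω(t,⟨2⟩) ≤ ω(t,s)` — the instance of the triangle inequality `ω(t,⟨2⟩) ≤ ω(t,s) ω(s,⟨2⟩)`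
(CVZ Prop. 3) used in Thm. 9 / Thm. 10, valid for the tree's infimum formalisation without any
finiteness hypothesis (see the module docstring for the junk cases).
[cite: ChristandlVranaZuiddam2021, Prop. 3 and Thm. 10] -/
theorem mul_relativeExponent_unit_le_relativeExponent {t : ι → κ → μ → K} {s : ι' → κ' → μ' → K}
    {ρ : ℝ}
    (hs : ∀ ε : ℝ, 0 < ε → ∃ N₀ : ℕ, ∀ N : ℕ, N₀ ≤ N → ∃ P : ℕ, (ρ - ε) * N ≤ P ∧
      TensorRestrictsTo (kroneckerPow s N) (kroneckerPow (unitTensor K 2) P)) :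
    ρ * relativeExponent t (unitTensor K 2) ≤ relativeExponent t s := by
  classical
  refine le_ciInf fun n => ?_
  have hνpos : (0 : ℝ) < (n : ℝ) + 1 := by positivity
  set b := relativeExponent t (unitTensor K 2)
  have hb0 : 0 ≤ b := relativeExponent_nonneg _ _
  by_cases hne : ∃ m, TensorRestrictsTo (kroneckerPow t m) (kroneckerPow s (n + 1))
  · -- the minimal witness `t^{⊗m} ≥ s^{⊗(n+1)}`
    set m := restrictionCost t s (n + 1)
    have hw : TensorRestrictsTo (kroneckerPow t m) (kroneckerPow s (n + 1)) :=
      tensorRestrictsTo_restrictionCost_of_nonempty hne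
    rw [le_div_iff₀ hνpos]
    by_cases hρ : ρ ≤ 0
    · have h1 : 0 ≤ -ρ * b * ((n : ℝ) + 1) := mul_nonneg (mul_nonneg (by linarith) hb0) hνpos.le
      have h2 : (0 : ℝ) ≤ m := Nat.cast_nonneg m
      linarith
    push Not at hρ
    -- main estimate: `(ρ - ε) b (n+1) ≤ m` for every `0 < ε < ρ`
    have key : ∀ ε : ℝ, 0 < ε → ε < ρ → (ρ - ε) * b * ((n : ℝ) + 1) ≤ m := by
      intro ε hε hερ
      obtain ⟨N₀, hN₀⟩ := hs ε hε
      obtain ⟨P, hP, hsP⟩ := hN₀ (N₀ + 1) (Nat.le_succ _)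
      have hPpos : (0 : ℝ) < P :=
        lt_of_lt_of_le (mul_pos (sub_pos.2 hερ) (by positivity)) hP
      obtain ⟨P', rfl⟩ : ∃ P', P = P' + 1 :=
        ⟨P - 1, by have : P ≠ 0 := (by rintro rfl; simp at hPpos); omega⟩
      -- chain the two witnesses: `t^{⊗(N₀+1)m} ≥ ⟨2⟩^{⊗(n+1)(P'+1)}`
      have hch : TensorRestrictsTo (kroneckerPow t ((N₀ + 1) * m))
          (kroneckerPow (unitTensor K 2) ((n * P' + n + P') + 1)) :=
        (tensorRestrictsTo_chain hw hsP).trans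
          (tensorMonRestrictsTo_kroneckerPow_of_eq (unitTensor K 2) (by ring)).tensorRestrictsTo
      have hle := relativeExponent_le_div hch
      have hDpos : (0 : ℝ) < ((n * P' + n + P' : ℕ) : ℝ) + 1 := by positivity
      have h1 : b * (((n * P' + n + P' : ℕ) : ℝ) + 1) ≤ (((N₀ + 1) * m : ℕ) : ℝ) :=
        (le_div_iff₀ hDpos).1 hle
      have h1' : b * ((n : ℝ) + 1) * ((P' : ℝ) + 1) ≤ ((N₀ : ℝ) + 1) * m := by
        have e1 : b * (((n * P' + n + P' : ℕ) : ℝ) + 1) = b * ((n : ℝ) + 1) * ((P' : ℝ) + 1) := by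
          push_cast; ring
        have e2 : (((N₀ + 1) * m : ℕ) : ℝ) = ((N₀ : ℝ) + 1) * m := by push_cast; ring
        rw [← e1, ← e2]
        exact h1
      have h2 : (ρ - ε) * ((N₀ : ℝ) + 1) ≤ (P' : ℝ) + 1 := by
        have := hP
        push_cast at this
        linarith
      have hbn : 0 ≤ b * ((n : ℝ) + 1) := mul_nonneg hb0 hνpos.le
      have h3 : (ρ - ε) * ((N₀ : ℝ) + 1) * (b * ((n : ℝ) + 1)) ≤ ((P' : ℝ) + 1) * (b * ((n : ℝ) + 1)) :=
        mul_le_mul_of_nonneg_right h2 hbn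
      have h4 : ((N₀ : ℝ) + 1) * ((ρ - ε) * b * ((n : ℝ) + 1)) ≤ ((N₀ : ℝ) + 1) * m :=
        calc ((N₀ : ℝ) + 1) * ((ρ - ε) * b * ((n : ℝ) + 1))
            = (ρ - ε) * ((N₀ : ℝ) + 1) * (b * ((n : ℝ) + 1)) := by ring
          _ ≤ ((P' : ℝ) + 1) * (b * ((n : ℝ) + 1)) := h3
          _ = b * ((n : ℝ) + 1) * ((P' : ℝ) + 1) := by ring
          _ ≤ ((N₀ : ℝ) + 1) * m := h1'
      exact le_of_mul_le_mul_left h4 (by positivity)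
    -- let `ε → 0`
    refine le_of_forall_pos_le_add fun δ hδ => ?_
    set B := b * ((n : ℝ) + 1) with hB_def
    have hB0 : 0 ≤ B := mul_nonneg hb0 hνpos.le
    set ε := min (ρ / 2) (δ / (B + 1))
    have hε : 0 < ε := lt_min (half_pos hρ) (div_pos hδ (by positivity))
    have hερ : ε < ρ := lt_of_le_of_lt (min_le_left _ _) (half_lt_self hρ)
    have hk := key ε hε hερ
    have hεB : ε * B ≤ δ := by
      have hle : ε ≤ δ / (B + 1) := min_le_right _ _
      calc ε * B ≤ δ / (B + 1) * B := mul_le_mul_of_nonneg_right hle hB0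
        _ ≤ δ / (B + 1) * (B + 1) :=
            mul_le_mul_of_nonneg_left (by linarith) (div_nonneg hδ.le (by positivity))
        _ = δ := div_mul_cancel₀ δ (by positivity)
    have e1 : ρ * b * ((n : ℝ) + 1) = (ρ - ε) * b * ((n : ℝ) + 1) + ε * B := by
      rw [hB_def]; ring
    rw [e1]
    linarith
  · -- no witness at all: then `ω(t,⟨2⟩)` is the junk `0`
    obtain ⟨q, hq⟩ := exists_unitTensor_pow_restrictsTo (kroneckerPow s (n + 1))
    have hb : b = 0 := by
      refine relativeExponent_eq_zero_of_not_exists (n := q) ?_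
      rintro ⟨m, hm⟩
      exact hne ⟨m, (hm.trans (unitTensorPow_succ_restrictsTo q)).trans hq⟩
    rw [hb, mul_zero]
    positivity

/-- **Rate for `s = ⟨2⟩^{⊗α} ⊗ ⟨2,2,2⟩^{⊗β}`** (`β ≥ 1`): for every `ε > 0` and all large `N` some
`P ≥ (α + 2β − ε) N` has `s^{⊗N} ≥ ⟨2⟩^{⊗P}` — from
`s^{⊗N} ≥ ⟨2⟩^{⊗Nα} ⊗ ⟨2,2,2⟩^{⊗Nβ} ≥ ⟨2⟩^{⊗Nα} ⊗ ⟨2⟩^{⊗r} ≥ ⟨2⟩^{⊗(Nα+r)}`, `r ≥ (2 − ε/β)Nβ`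
(`Q̃(⟨2,2,2⟩) ≥ 4`, `exists_tensorMonRestrictsTo_kroneckerPow_matMulTensor_unitTensor`). This is
the constructive content of CVZ's `ω(⟨2⟩^α⟨2,2,2⟩^β, ⟨2⟩) = 1/(α + 2β)` (proof of Thm. 10).
[cite: ChristandlVranaZuiddam2021, Thm. 10 (proof)] -/
theorem unitPow_kronecker_matMulPow_rate (K : Type u) [CommSemiring K] (α β : ℕ) (hβ : 0 < β) :
    ∀ ε : ℝ, 0 < ε → ∃ N₀ : ℕ, ∀ N : ℕ, N₀ ≤ N → ∃ P : ℕ, (((α : ℝ) + 2 * β) - ε) * N ≤ P ∧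
      TensorRestrictsTo
        (kroneckerPow (kroneckerTensor (kroneckerPow (unitTensor K 2) α)
          (kroneckerPow (matMulTensor K 2 2 2) β)) N)
        (kroneckerPow (unitTensor K 2) P) := by
  intro ε hε
  have hβpos : (0 : ℝ) < β := by exact_mod_cast hβ
  set ε' : ℝ := min (ε / β) 1
  have hε'pos : 0 < ε' := lt_min (div_pos hε hβpos) one_pos
  obtain ⟨L₀, hL₀⟩ :=
    exists_tensorMonRestrictsTo_kroneckerPow_matMulTensor_unitTensor K hε'pos (min_le_right _ _)
  refine ⟨L₀, fun N hN => ?_⟩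
  obtain ⟨r, hr, hmono⟩ := hL₀ (N * β) (le_trans hN (Nat.le_mul_of_pos_right N hβ))
  refine ⟨N * α + r, ?_, ?_⟩
  · have h1 : ε' * β ≤ ε :=
      calc ε' * β ≤ ε / β * β := mul_le_mul_of_nonneg_right (min_le_left _ _) hβpos.le
        _ = ε := div_mul_cancel₀ ε hβpos.ne'
    have hN0 : (0 : ℝ) ≤ N := Nat.cast_nonneg N
    have hr' : (2 - ε') * ((N : ℝ) * β) ≤ r := by
      have := hr
      push_cast at this
      exact this
    have h2 : (N : ℝ) * (ε' * β) ≤ N * ε := mul_le_mul_of_nonneg_left h1 hN0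
    have e : (((α : ℝ) + 2 * β) - ε) * N = N * α + (2 - ε') * ((N : ℝ) * β) - (N * ε - N * (ε' * β)) := by
      ring
    push_cast
    rw [e]
    linarith
  · have h1 := (tensorMonRestrictsTo_kroneckerPow_kronecker (kroneckerPow (unitTensor K 2) α)
      (kroneckerPow (matMulTensor K 2 2 2) β) N).tensorRestrictsTo
    have h2 := (tensorMonRestrictsTo_kroneckerPow_mul' (unitTensor K 2) N α).tensorRestrictsTo
    have h3 := (tensorMonRestrictsTo_kroneckerPow_mul' (matMulTensor K 2 2 2) N β).tensorRestrictsTo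
    have h5 := (tensorMonRestrictsTo_kroneckerPow_add' (unitTensor K 2) (N * α) r).tensorRestrictsTo
    exact h1.trans ((h2.kronecker (h3.trans hmono.tensorRestrictsTo)).trans h5)

end Rate

/-- **CVZ 2021, Theorem 10, proved**: for every 3-tensor `t` over a field and `α, β ∈ ℕ`, `β > 0`,
`2 i(t) + (α/β)(i(t) − 1) ≤ (ω(⟨2⟩,t) · ω(t, ⟨2⟩^{⊗α} ⊗ ⟨2,2,2⟩^{⊗β}) − α)/β` — the named fact
`CVZ2021_thm10` holds (its Assumption-1 hypothesis is not used). With `a = ω(⟨2⟩,t) ≥ 0`,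
`i(t) = a · ω(t,⟨2⟩)` (Def. 4), this is `a · (★)` rearranged, (★) being
`mul_relativeExponent_unit_le_relativeExponent` fed with `unitPow_kronecker_matMulPow_rate`.
[cite: ChristandlVranaZuiddam2021, Thm. 10] -/
theorem CVZ2021_thm10_holds : CVZ2021_thm10 := by
  intro K _ ι κ μ _ _ _ t _ α β hβ
  have hβpos : (0 : ℝ) < β := by exact_mod_cast hβ
  set a := relativeExponent (unitTensor K 2) t
  set b := relativeExponent t (unitTensor K 2)
  set c := relativeExponent t (kroneckerTensor (kroneckerPow (unitTensor K 2) α)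
    (kroneckerPow (matMulTensor K 2 2 2) β))
  have ha : 0 ≤ a := relativeExponent_nonneg _ _
  have key : ((α : ℝ) + 2 * β) * b ≤ c :=
    mul_relativeExponent_unit_le_relativeExponent (unitPow_kronecker_matMulPow_rate K α β hβ)
  have hak : a * (((α : ℝ) + 2 * β) * b) ≤ a * c := mul_le_mul_of_nonneg_left key ha
  have hi : irreversibility t = a * b := rfl
  have hβne : (β : ℝ) ≠ 0 := hβpos.ne'
  rw [hi, le_div_iff₀ hβpos]
  calc (2 * (a * b) + (α : ℝ) / β * (a * b - 1)) * β = a * (((α : ℝ) + 2 * β) * b) - α := by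
        field_simp
        ring
    _ ≤ a * c - α := by linarith

end Literature.Barriers.MatrixMultiplication

end
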